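import Literature.MathematicalPhysics.QuantumLattice.TwistedAdjointLaplacianGap
import HarnessLib

/-!
# Lattice 1-forms on the `ℓ × ℓ` twisted torus: the quadratic Wilson action plus the Feynman-gauge term has the sharp
# gap `4 sin²(π/(Nℓ))` (discrete Weitzenböck identity, explicit form)

Topic `Literature/MathematicalPhysics/QuantumLattice`; sequel of `TwistedAdjointLaplacianGap.lean` (the 0-FORM statement
★ `twistedTorus_poincare_sharp`: for a unitary Weyl pair `A B = ω·B A`, `ω` primitive, and a traceless adjoint field `Φ : ℕ² → M_N(ℂ)`
with twisted periodicity `Φ(x+ℓ,y) = AΦA†`, `Φ(x,y+ℓ) = BΦB†`, `4 sin²(π/(Nℓ))·Σ_{x,y<ℓ} S(Φ) ≤ Σ_{x,y<ℓ} [S(∂₀Φ) + S(∂₁Φ)]`,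
`S(X) = Re tr(X†X)`, `∂₀Φ(x,y) = Φ(x+1,y) − Φ(x,y)`, `∂₁Φ(x,y) = Φ(x,y+1) − Φ(x,y)`) and the explicit, two-direction instance of
the operator identity of `Literature/Analysis/OperatorTheory/DiscreteWeitzenboeckIdentity.lean`.

A lattice 1-FORM on the twisted torus (a fluctuation `A_μ` of the link field around the twist-eating zero-action configuration,
in the transition-function picture where covariant differences are plain forward differences and the twist sits in the boundary
condition) is a pair `a₀, a₁ : ℕ → ℕ → M_N(ℂ)` of twisted-periodic fields.  Its linearised field strength is the plaquette
quantity `G(x,y) = ∂₀a₁(x,y) − ∂₁a₀(x,y)` («`G_{μν}(n) = ∇_μ⁺A_ν(n) − ∇_ν⁺A_μ(n) + O(g)`», García Pérez–González-Arroyo–Okawa 2017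
§2.3) and its BACKWARD covariant divergence, written on the window shifted by `(1,1)` so that every index is a natural number, is
`δ(x,y) = [a₀(x+1,y+1) − a₀(x,y+1)] + [a₁(x+1,y+1) − a₁(x+1,y)] = (∇₀⁻a₀ + ∇₁⁻a₁)(x+1,y+1)` (the background-field gauge-fixing
function, «`S_GF = ξ⁻¹ Σ_n Tr(∇_μ⁻A_μ(n))²`, `∇_μ⁻` minus the adjoint of `∇_μ⁺`», op. cit. §2.5).

* ★ `twistedTorus_oneForm_weitzenboeck` (A, B unitary; nothing else): over one period,
  `Σ S(G) + Σ S(δ) = Σ [S(∂₀a₀) + S(∂₁a₀) + S(∂₀a₁) + S(∂₁a₁)]` — Wilson quadratic form + `ξ = 1` gauge-fixing term = the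
  componentwise twisted adjoint Laplacian form («in Feynman gauge the propagator of the gauge field reads `δ_{μν}/q̂²`», op. cit.
  §2.5).  Proof: expand both squares; the cross terms `Σ Re tr((∇₀⁻a₀)†(∇₁⁻a₁))` and `Σ Re tr((∂₀a₁)†(∂₁a₀))` agree after two
  summations by parts, which on the periodic window are index SHIFTS (`Σ_{x<ℓ} F(x+1) = Σ_{x<ℓ} F(x)` for `ℓ`-periodic `F`; the
  Hilbert–Schmidt pairings of twisted-periodic fields are periodic because `Ad A`, `Ad B` are isometries);
* ★★ `twistedTorus_oneForm_gap` (Weyl pair, `ω` primitive, `a₀, a₁` traceless):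
  `4 sin²(π/(Nℓ)) · Σ_{x,y<ℓ} [S(a₀) + S(a₁)] ≤ Σ S(∂₀a₁ − ∂₁a₀) + Σ S(δ)` — the FEYNMAN-GAUGE fluctuation operator of the twisted
  torus on `su(N)`-valued 1-forms has the same sharp gap as the 0-form Laplacian, the square `|1 − e^{2πi/(Nℓ)}|²` of the smallest
  twisted momentum («momentum quantized in units of `2π/(N l_μ)` … excluding zero», GPGAO 2014 §3);
* ★ `twistedTorus_oneForm_gap_of_div_eq_zero` — COULOMB GAUGE: if `δ ≡ 0` then `4 sin²(π/(Nℓ))·Σ[S(a₀) + S(a₁)] ≤ Σ S(∂₀a₁ − ∂₁a₀)`: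
  the tree-level Hessian of the Wilson action at the twist eater, restricted to the gauge slice, has NO ZERO MODE and gap
  `≥ 4 sin²(π/(Nℓ))` («the irreducibility condition eliminates the presence of zero-modes», op. cit. §2.2).

* §5 — the twisted SLAB `ℓ × ℓ × L` (two twist-eating directions, a third PERIODIC direction of any length `L`; 1-forms
  `a₀, a₁, a₂ : ℕ³ → M_N(ℂ)`): ★ `twistedSlab_oneForm_weitzenboeck` (three plaquette squares + squared backward divergence = nine
  componentwise Dirichlet terms), ★★ `twistedSlab_oneForm_gap` (Feynman gauge) and ★★ `twistedSlab_oneForm_gap_of_div_eq_zero`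
  (Coulomb slice): `4 sin²(π/(Nℓ)) · Σ [S(a₀) + S(a₁) + S(a₂)] ≤ Σ_{μ<ν} S(∂_μ a_ν − ∂_ν a_μ) (+ Σ S(div))` with a constant
  INDEPENDENT OF `L` — the spatial Hessian of the Wilson action of the twisted slab at the twist eater has no zero mode modulo
  gauge, uniformly in the long extent (the geometry of the anchor T1 of `twisted-slab-continuity`).

Scope: explicit forms for the `ℓ × ℓ` torus and the `ℓ × ℓ × L` slab; the four-index tube with a second periodic direction is the
same computation (or the abstract identity `DiscreteWeitzenboeck.half_sum_curl_sq_add_div_sq` with `twistedTube_poincare_sharp`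
as 0-form input) — `-- TODO(general form)`: explicit four-index tube version.

HONEST FRAMING: tree-level quadratic forms of ONE twisted box at fixed lattice spacing; nothing on interacting corrections,
`β`-uniformity, uniform vacuum dominance (anchor T1 of `twisted-slab-continuity`: 0/1), purity, `IRcof`/`IR`, or the Yang–Mills
mass gap (Clay), which is NOT proved; `R4` closes only `BalabanLadder.UV`.

References: M. García Pérez, A. González-Arroyo, M. Okawa, JHEP 10 (2017) 150 = arXiv:1708.00841, §2.2–§2.5 (corpus
`paper:arxiv-1708.00841` p0006 L19–L35, p0009 L32–L84); the same, IJMPA 29 (2014) 1445001 = arXiv:1406.5655, §3 (corpus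
`paper:arxiv-1406.5655` p0006); A. González-Arroyo, C. P. Korthals Altes, Nucl. Phys. B 311 (1988) 433.
-/

noncomputable section

open scoped Matrix
open Finset

namespace Literature.MathematicalPhysics.QuantumLattice

variable {N : ℕ}

/-! ## §1 The polarised Hilbert–Schmidt pairing `Re tr(X†Y)` -/

section Pairing

/-- Symmetry `Re tr(X†Y) = Re tr(Y†X)`. [folklore] -/
private theorem hsRe_symm (X Y : Matrix (Fin N) (Fin N) ℂ) : ((Xᴴ * Y).trace).re = ((Yᴴ * X).trace).re := by
  have h : Yᴴ * X = (Xᴴ * Y)ᴴ := by rw [Matrix.conjTranspose_mul, Matrix.conjTranspose_conjTranspose]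
  rw [h, Matrix.trace_conjTranspose, Complex.star_def, Complex.conj_re]

/-- `S(X − Y) = S(X) + S(Y) − 2 Re tr(X†Y)`. [folklore] -/
private theorem hsS_sub (X Y : Matrix (Fin N) (Fin N) ℂ) :
    (((X - Y)ᴴ * (X - Y)).trace).re =
      ((Xᴴ * X).trace).re + ((Yᴴ * Y).trace).re - 2 * ((Xᴴ * Y).trace).re := by
  rw [Matrix.conjTranspose_sub, Matrix.sub_mul, Matrix.mul_sub, Matrix.mul_sub, Matrix.trace_sub, Matrix.trace_sub,
    Matrix.trace_sub, Complex.sub_re, Complex.sub_re, Complex.sub_re, hsRe_symm Y X]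
  ring

/-- `S(X + Y) = S(X) + S(Y) + 2 Re tr(X†Y)`. [folklore] -/
private theorem hsS_add (X Y : Matrix (Fin N) (Fin N) ℂ) :
    (((X + Y)ᴴ * (X + Y)).trace).re =
      ((Xᴴ * X).trace).re + ((Yᴴ * Y).trace).re + 2 * ((Xᴴ * Y).trace).re := by
  rw [Matrix.conjTranspose_add, Matrix.add_mul, Matrix.mul_add, Matrix.mul_add, Matrix.trace_add, Matrix.trace_add,
    Matrix.trace_add, Complex.add_re, Complex.add_re, Complex.add_re, hsRe_symm Y X]
  ring

/-- Bilinear expansion `Re tr((X − X')†(Y − Y')) = Re tr(X†Y) − Re tr(X†Y') − Re tr(X'†Y) + Re tr(X'†Y')`. [folklore] -/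
private theorem hsRe_sub_sub (X X' Y Y' : Matrix (Fin N) (Fin N) ℂ) :
    (((X - X')ᴴ * (Y - Y')).trace).re =
      ((Xᴴ * Y).trace).re - ((Xᴴ * Y').trace).re - ((X'ᴴ * Y).trace).re + ((X'ᴴ * Y').trace).re := by
  rw [Matrix.conjTranspose_sub, Matrix.sub_mul, Matrix.mul_sub, Matrix.mul_sub, Matrix.trace_sub, Matrix.trace_sub,
    Matrix.trace_sub, Complex.sub_re, Complex.sub_re, Complex.sub_re]
  ring

/-- `Ad U` is an isometry for the pairing: `Re tr((UXU†)†(UYU†)) = Re tr(X†Y)` for `U†U = 1`. [folklore] -/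
private theorem hsRe_conj {U : Matrix (Fin N) (Fin N) ℂ} (hU : Uᴴ * U = 1) (X Y : Matrix (Fin N) (Fin N) ℂ) :
    (((U * X * Uᴴ)ᴴ * (U * Y * Uᴴ)).trace).re = ((Xᴴ * Y).trace).re := by
  have hm : (U * X * Uᴴ)ᴴ * (U * Y * Uᴴ) = U * (Xᴴ * Y * Uᴴ) := by
    rw [Matrix.conjTranspose_mul, Matrix.conjTranspose_mul, Matrix.conjTranspose_conjTranspose]
    calc U * (Xᴴ * Uᴴ) * (U * Y * Uᴴ) = U * (Xᴴ * (Uᴴ * U) * Y) * Uᴴ := by simp only [Matrix.mul_assoc]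
      _ = U * (Xᴴ * Y) * Uᴴ := by rw [hU, Matrix.mul_one]
      _ = U * (Xᴴ * Y * Uᴴ) := by rw [Matrix.mul_assoc]
  rw [hm, Matrix.trace_mul_comm, Matrix.mul_assoc, hU, Matrix.mul_one]

end Pairing

/-! ## §2 Summation by parts on the periodic window = index shifts -/

section Shifts

/-- `Σ_{x<ℓ} F(x+1) = Σ_{x<ℓ} F(x)` for an `ℓ`-periodic real sequence. [folklore] -/
private theorem sum_range_shift_one {F : ℕ → ℝ} {ℓ : ℕ} (hF : ∀ x, F (x + ℓ) = F x) :
    ∑ x ∈ range ℓ, F (x + 1) = ∑ x ∈ range ℓ, F x := by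
  rcases Nat.eq_zero_or_pos ℓ with hℓ | hℓ
  · subst hℓ; simp
  · obtain ⟨m, rfl⟩ : ∃ m, ℓ = m + 1 := ⟨ℓ - 1, by omega⟩
    rw [Finset.sum_range_succ, Finset.sum_range_succ']
    have h : F (m + 1) = F 0 := by rw [← hF 0, zero_add]
    rw [h]

/-- Window shift in the first index. [folklore] -/
private theorem wsum_shift_x {F : ℕ → ℕ → ℝ} {ℓ : ℕ} (hF : ∀ x y, F (x + ℓ) y = F x y) :
    ∑ x ∈ range ℓ, ∑ y ∈ range ℓ, F (x + 1) y = ∑ x ∈ range ℓ, ∑ y ∈ range ℓ, F x y := by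
  calc ∑ x ∈ range ℓ, ∑ y ∈ range ℓ, F (x + 1) y = ∑ y ∈ range ℓ, ∑ x ∈ range ℓ, F (x + 1) y := Finset.sum_comm
    _ = ∑ y ∈ range ℓ, ∑ x ∈ range ℓ, F x y :=
        Finset.sum_congr rfl fun y _ => sum_range_shift_one (F := fun x => F x y) fun x => hF x y
    _ = ∑ x ∈ range ℓ, ∑ y ∈ range ℓ, F x y := Finset.sum_comm

/-- Window shift in the second index. [folklore] -/
private theorem wsum_shift_y {F : ℕ → ℕ → ℝ} {ℓ : ℕ} (hF : ∀ x y, F x (y + ℓ) = F x y) :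
    ∑ x ∈ range ℓ, ∑ y ∈ range ℓ, F x (y + 1) = ∑ x ∈ range ℓ, ∑ y ∈ range ℓ, F x y :=
  Finset.sum_congr rfl fun x _ => sum_range_shift_one (F := fun y => F x y) fun y => hF x y

end Shifts

/-! ## §3 The explicit Weitzenböck identity on the twisted torus -/

section OneForm

variable {A B : Matrix (Fin N) (Fin N) ℂ} {ℓ : ℕ} {a₀ a₁ : ℕ → ℕ → Matrix (Fin N) (Fin N) ℂ}

/-- The three summations by parts behind the cross terms: for twisted-periodic `a₀, a₁` (unitary `A, B`),
`Σ Re tr((∇₀⁻a₀)†(∇₁⁻a₁))(x+1,y+1) = Σ Re tr((∂₀a₁)†(∂₁a₀))(x,y)` over the window `x, y < ℓ`. [folklore] -/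
private theorem cross_terms_eq (hA : Aᴴ * A = 1) (hB : Bᴴ * B = 1)
    (h00 : ∀ x y, a₀ (x + ℓ) y = A * a₀ x y * Aᴴ) (h01 : ∀ x y, a₀ x (y + ℓ) = B * a₀ x y * Bᴴ)
    (h10 : ∀ x y, a₁ (x + ℓ) y = A * a₁ x y * Aᴴ) (h11 : ∀ x y, a₁ x (y + ℓ) = B * a₁ x y * Bᴴ) :
    ∑ x ∈ range ℓ, ∑ y ∈ range ℓ,
        (((a₀ (x + 1) (y + 1) - a₀ x (y + 1))ᴴ * (a₁ (x + 1) (y + 1) - a₁ (x + 1) y)).trace).re =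
      ∑ x ∈ range ℓ, ∑ y ∈ range ℓ,
        (((a₁ (x + 1) y - a₁ x y)ᴴ * (a₀ x (y + 1) - a₀ x y)).trace).re := by
  -- the four pairings `T[p,q;r,s] = Σ Re tr(a₀(x+p,y+q)† a₁(x+r,y+s))` and their shift relations
  have hT1 : ∑ x ∈ range ℓ, ∑ y ∈ range ℓ, (((a₀ (x + 1) (y + 1))ᴴ * a₁ (x + 1) (y + 1)).trace).re =
      ∑ x ∈ range ℓ, ∑ y ∈ range ℓ, (((a₀ x y)ᴴ * a₁ x y).trace).re := by
    have h1 := wsum_shift_x (F := fun x y => (((a₀ x (y + 1))ᴴ * a₁ x (y + 1)).trace).re) (ℓ := ℓ)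
      (fun x y => by rw [h00, h10, hsRe_conj hA])
    have h2 := wsum_shift_y (F := fun x y => (((a₀ x y)ᴴ * a₁ x y).trace).re) (ℓ := ℓ)
      (fun x y => by rw [h01, h11, hsRe_conj hB])
    rw [h1, h2]
  have hT2 : ∑ x ∈ range ℓ, ∑ y ∈ range ℓ, (((a₀ (x + 1) (y + 1))ᴴ * a₁ (x + 1) y).trace).re =
      ∑ x ∈ range ℓ, ∑ y ∈ range ℓ, (((a₀ x (y + 1))ᴴ * a₁ x y).trace).re := by
    have h1 := wsum_shift_x (F := fun x y => (((a₀ x (y + 1))ᴴ * a₁ x y).trace).re) (ℓ := ℓ)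
      (fun x y => by rw [h00, h10, hsRe_conj hA])
    rw [h1]
  have hT3 : ∑ x ∈ range ℓ, ∑ y ∈ range ℓ, (((a₀ x (y + 1))ᴴ * a₁ (x + 1) (y + 1)).trace).re =
      ∑ x ∈ range ℓ, ∑ y ∈ range ℓ, (((a₀ x y)ᴴ * a₁ (x + 1) y).trace).re := by
    have h2 := wsum_shift_y (F := fun x y => (((a₀ x y)ᴴ * a₁ (x + 1) y).trace).re) (ℓ := ℓ)
      (fun x y => by rw [h01, h11, hsRe_conj hB])
    rw [h2]
  -- expand both sides bilinearly
  have hL : ∀ x y, (((a₀ (x + 1) (y + 1) - a₀ x (y + 1))ᴴ * (a₁ (x + 1) (y + 1) - a₁ (x + 1) y)).trace).re =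
      (((a₀ (x + 1) (y + 1))ᴴ * a₁ (x + 1) (y + 1)).trace).re - (((a₀ (x + 1) (y + 1))ᴴ * a₁ (x + 1) y).trace).re -
        (((a₀ x (y + 1))ᴴ * a₁ (x + 1) (y + 1)).trace).re + (((a₀ x (y + 1))ᴴ * a₁ (x + 1) y).trace).re :=
    fun x y => hsRe_sub_sub _ _ _ _
  have hR : ∀ x y, (((a₁ (x + 1) y - a₁ x y)ᴴ * (a₀ x (y + 1) - a₀ x y)).trace).re =
      (((a₀ x (y + 1))ᴴ * a₁ (x + 1) y).trace).re - (((a₀ x (y + 1))ᴴ * a₁ x y).trace).re -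
        (((a₀ x y)ᴴ * a₁ (x + 1) y).trace).re + (((a₀ x y)ᴴ * a₁ x y).trace).re := by
    intro x y
    rw [hsRe_symm, hsRe_sub_sub]
  simp_rw [hL, hR]
  simp only [Finset.sum_add_distrib, Finset.sum_sub_distrib]
  rw [hT1, hT2, hT3]
  ring

/-- ★ **The discrete Weitzenböck identity on the `ℓ × ℓ` twisted torus, explicit form.**  For twisted-periodic 1-forms
`a₀, a₁` (`a_μ(x+ℓ,y) = A a_μ(x,y) A†`, `a_μ(x,y+ℓ) = B a_μ(x,y) B†`, `A, B` unitary) the quadratic Wilson action (squared linearised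
field strength `∂₀a₁ − ∂₁a₀`) plus the `ξ = 1` background-field gauge-fixing term (squared backward covariant divergence, written on
the shifted window) equals the componentwise twisted adjoint Dirichlet form:
`Σ_{x,y<ℓ} S(∂₀a₁ − ∂₁a₀) + Σ_{x,y<ℓ} S((∇₀⁻a₀ + ∇₁⁻a₁)(x+1,y+1)) = Σ_{x,y<ℓ} [S(∂₀a₀) + S(∂₁a₀) + S(∂₀a₁) + S(∂₁a₁)]`
(«in Feynman gauge the propagator of the gauge field reads `δ_{μν}/q̂²`»).
[cite: GarciaperezGonzalezarroyoOkawa2017, §2.5] [cite: GarciaperezGonzalezarroyoOkawa2014, §3] -/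
theorem twistedTorus_oneForm_weitzenboeck (hAu : A ∈ Matrix.unitaryGroup (Fin N) ℂ)
    (hBu : B ∈ Matrix.unitaryGroup (Fin N) ℂ)
    (h00 : ∀ x y, a₀ (x + ℓ) y = A * a₀ x y * Aᴴ) (h01 : ∀ x y, a₀ x (y + ℓ) = B * a₀ x y * Bᴴ)
    (h10 : ∀ x y, a₁ (x + ℓ) y = A * a₁ x y * Aᴴ) (h11 : ∀ x y, a₁ x (y + ℓ) = B * a₁ x y * Bᴴ) :
    ∑ x ∈ range ℓ, ∑ y ∈ range ℓ,
        ((((a₁ (x + 1) y - a₁ x y) - (a₀ x (y + 1) - a₀ x y))ᴴ *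
          ((a₁ (x + 1) y - a₁ x y) - (a₀ x (y + 1) - a₀ x y))).trace).re +
      ∑ x ∈ range ℓ, ∑ y ∈ range ℓ,
        ((((a₀ (x + 1) (y + 1) - a₀ x (y + 1)) + (a₁ (x + 1) (y + 1) - a₁ (x + 1) y))ᴴ *
          ((a₀ (x + 1) (y + 1) - a₀ x (y + 1)) + (a₁ (x + 1) (y + 1) - a₁ (x + 1) y))).trace).re =
      ∑ x ∈ range ℓ, ∑ y ∈ range ℓ,
        ((((a₀ (x + 1) y - a₀ x y)ᴴ * (a₀ (x + 1) y - a₀ x y)).trace).re +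
          (((a₀ x (y + 1) - a₀ x y)ᴴ * (a₀ x (y + 1) - a₀ x y)).trace).re +
          (((a₁ (x + 1) y - a₁ x y)ᴴ * (a₁ (x + 1) y - a₁ x y)).trace).re +
          (((a₁ x (y + 1) - a₁ x y)ᴴ * (a₁ x (y + 1) - a₁ x y)).trace).re) := by
  have hA : Aᴴ * A = 1 := hAu.1
  have hB : Bᴴ * B = 1 := hBu.1
  -- the shifted diagonal terms of the divergence square
  have hD0 : ∑ x ∈ range ℓ, ∑ y ∈ range ℓ,
      (((a₀ (x + 1) (y + 1) - a₀ x (y + 1))ᴴ * (a₀ (x + 1) (y + 1) - a₀ x (y + 1))).trace).re =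
      ∑ x ∈ range ℓ, ∑ y ∈ range ℓ, (((a₀ (x + 1) y - a₀ x y)ᴴ * (a₀ (x + 1) y - a₀ x y)).trace).re := by
    have h := wsum_shift_y (ℓ := ℓ)
      (F := fun x y => (((a₀ (x + 1) y - a₀ x y)ᴴ * (a₀ (x + 1) y - a₀ x y)).trace).re)
      (fun x y => by
        rw [h01, h01, ← Matrix.sub_mul, ← Matrix.mul_sub, re_trace_conjTranspose_mul_self_conj hB])
    rw [h]
  have hD1 : ∑ x ∈ range ℓ, ∑ y ∈ range ℓ,
      (((a₁ (x + 1) (y + 1) - a₁ (x + 1) y)ᴴ * (a₁ (x + 1) (y + 1) - a₁ (x + 1) y)).trace).re =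
      ∑ x ∈ range ℓ, ∑ y ∈ range ℓ, (((a₁ x (y + 1) - a₁ x y)ᴴ * (a₁ x (y + 1) - a₁ x y)).trace).re := by
    have h := wsum_shift_x (ℓ := ℓ)
      (F := fun x y => (((a₁ x (y + 1) - a₁ x y)ᴴ * (a₁ x (y + 1) - a₁ x y)).trace).re)
      (fun x y => by
        rw [h10, h10, ← Matrix.sub_mul, ← Matrix.mul_sub, re_trace_conjTranspose_mul_self_conj hA])
    rw [h]
  have hX := cross_terms_eq hA hB h00 h01 h10 h11
  -- expand the squares
  have hcurl : ∀ x y, ((((a₁ (x + 1) y - a₁ x y) - (a₀ x (y + 1) - a₀ x y))ᴴ *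
      ((a₁ (x + 1) y - a₁ x y) - (a₀ x (y + 1) - a₀ x y))).trace).re =
      (((a₁ (x + 1) y - a₁ x y)ᴴ * (a₁ (x + 1) y - a₁ x y)).trace).re +
        (((a₀ x (y + 1) - a₀ x y)ᴴ * (a₀ x (y + 1) - a₀ x y)).trace).re -
        2 * (((a₁ (x + 1) y - a₁ x y)ᴴ * (a₀ x (y + 1) - a₀ x y)).trace).re := fun x y => hsS_sub _ _
  have hdiv : ∀ x y, ((((a₀ (x + 1) (y + 1) - a₀ x (y + 1)) + (a₁ (x + 1) (y + 1) - a₁ (x + 1) y))ᴴ *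
      ((a₀ (x + 1) (y + 1) - a₀ x (y + 1)) + (a₁ (x + 1) (y + 1) - a₁ (x + 1) y))).trace).re =
      (((a₀ (x + 1) (y + 1) - a₀ x (y + 1))ᴴ * (a₀ (x + 1) (y + 1) - a₀ x (y + 1))).trace).re +
        (((a₁ (x + 1) (y + 1) - a₁ (x + 1) y)ᴴ * (a₁ (x + 1) (y + 1) - a₁ (x + 1) y)).trace).re +
        2 * (((a₀ (x + 1) (y + 1) - a₀ x (y + 1))ᴴ * (a₁ (x + 1) (y + 1) - a₁ (x + 1) y)).trace).re :=
    fun x y => hsS_add _ _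
  simp_rw [hcurl, hdiv]
  simp only [Finset.sum_add_distrib, Finset.sum_sub_distrib, ← Finset.mul_sum]
  rw [hD0, hD1, hX]
  ring

/-! ## §4 The sharp gap for 1-forms: Feynman gauge and Coulomb gauge -/

variable [NeZero N] {ω : ℂ}

/-- ★★ **Feynman-gauge gap for 1-forms on the twisted torus.**  For a unitary Weyl pair `A B = ω·B A` (`ω` a primitive `N`-th
root of unity) and traceless twisted-periodic 1-forms `a₀, a₁`:
`4 sin²(π/(Nℓ)) · Σ_{x,y<ℓ} [S(a₀) + S(a₁)] ≤ Σ S(∂₀a₁ − ∂₁a₀) + Σ S((∇₀⁻a₀ + ∇₁⁻a₁)(x+1,y+1))` — the gauge-fixed (`ξ = 1`)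
quadratic fluctuation operator around the twist-eating configuration has NO ZERO MODE on `su(N)` and gap exactly the square
`|1 − e^{2πi/(Nℓ)}|²` of the smallest twisted momentum («momentum quantized … excluding zero … an infrared cut-off»).
[cite: GarciaperezGonzalezarroyoOkawa2017, §2.5] [cite: GarciaperezGonzalezarroyoOkawa2014, §3] -/
theorem twistedTorus_oneForm_gap (hAu : A ∈ Matrix.unitaryGroup (Fin N) ℂ) (hBu : B ∈ Matrix.unitaryGroup (Fin N) ℂ)
    (hω : IsPrimitiveRoot ω N) (hAB : A * B = ω • (B * A))
    (h00 : ∀ x y, a₀ (x + ℓ) y = A * a₀ x y * Aᴴ) (h01 : ∀ x y, a₀ x (y + ℓ) = B * a₀ x y * Bᴴ)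
    (h10 : ∀ x y, a₁ (x + ℓ) y = A * a₁ x y * Aᴴ) (h11 : ∀ x y, a₁ x (y + ℓ) = B * a₁ x y * Bᴴ)
    (htr0 : ∀ x y, (a₀ x y).trace = 0) (htr1 : ∀ x y, (a₁ x y).trace = 0) :
    4 * Real.sin (Real.pi / ((N : ℝ) * ℓ)) ^ 2 *
        ∑ x ∈ range ℓ, ∑ y ∈ range ℓ, ((((a₀ x y)ᴴ * a₀ x y).trace).re + (((a₁ x y)ᴴ * a₁ x y).trace).re) ≤
      ∑ x ∈ range ℓ, ∑ y ∈ range ℓ,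
          ((((a₁ (x + 1) y - a₁ x y) - (a₀ x (y + 1) - a₀ x y))ᴴ *
            ((a₁ (x + 1) y - a₁ x y) - (a₀ x (y + 1) - a₀ x y))).trace).re +
        ∑ x ∈ range ℓ, ∑ y ∈ range ℓ,
          ((((a₀ (x + 1) (y + 1) - a₀ x (y + 1)) + (a₁ (x + 1) (y + 1) - a₁ (x + 1) y))ᴴ *
            ((a₀ (x + 1) (y + 1) - a₀ x (y + 1)) + (a₁ (x + 1) (y + 1) - a₁ (x + 1) y))).trace).re := by
  rw [twistedTorus_oneForm_weitzenboeck hAu hBu h00 h01 h10 h11]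
  have h0 := twistedTorus_poincare_sharp hAu hBu hω hAB h00 h01 htr0
  have h1 := twistedTorus_poincare_sharp hAu hBu hω hAB h10 h11 htr1
  have hsplit : ∑ x ∈ range ℓ, ∑ y ∈ range ℓ,
      ((((a₀ (x + 1) y - a₀ x y)ᴴ * (a₀ (x + 1) y - a₀ x y)).trace).re +
        (((a₀ x (y + 1) - a₀ x y)ᴴ * (a₀ x (y + 1) - a₀ x y)).trace).re +
        (((a₁ (x + 1) y - a₁ x y)ᴴ * (a₁ (x + 1) y - a₁ x y)).trace).re +
        (((a₁ x (y + 1) - a₁ x y)ᴴ * (a₁ x (y + 1) - a₁ x y)).trace).re) =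
      ∑ x ∈ range ℓ, ∑ y ∈ range ℓ,
        ((((a₀ (x + 1) y - a₀ x y)ᴴ * (a₀ (x + 1) y - a₀ x y)).trace).re +
          (((a₀ x (y + 1) - a₀ x y)ᴴ * (a₀ x (y + 1) - a₀ x y)).trace).re) +
      ∑ x ∈ range ℓ, ∑ y ∈ range ℓ,
        ((((a₁ (x + 1) y - a₁ x y)ᴴ * (a₁ (x + 1) y - a₁ x y)).trace).re +
          (((a₁ x (y + 1) - a₁ x y)ᴴ * (a₁ x (y + 1) - a₁ x y)).trace).re) := by
    rw [← Finset.sum_add_distrib]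
    refine Finset.sum_congr rfl fun x _ => ?_
    rw [← Finset.sum_add_distrib]
    refine Finset.sum_congr rfl fun y _ => ?_
    ring
  rw [hsplit]
  have hmass : ∑ x ∈ range ℓ, ∑ y ∈ range ℓ, ((((a₀ x y)ᴴ * a₀ x y).trace).re + (((a₁ x y)ᴴ * a₁ x y).trace).re) =
      ∑ x ∈ range ℓ, ∑ y ∈ range ℓ, (((a₀ x y)ᴴ * a₀ x y).trace).re +
        ∑ x ∈ range ℓ, ∑ y ∈ range ℓ, (((a₁ x y)ᴴ * a₁ x y).trace).re := by
    rw [← Finset.sum_add_distrib]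
    refine Finset.sum_congr rfl fun x _ => ?_
    rw [← Finset.sum_add_distrib]
  rw [hmass, mul_add]
  exact add_le_add h0 h1

/-- ★ **Coulomb-gauge Hessian bound on the twisted torus.**  If in addition the backward covariant divergence vanishes,
`(∇₀⁻a₀ + ∇₁⁻a₁)(x+1,y+1) = 0` for all `x, y`, then the quadratic Wilson action ALONE controls the fluctuation:
`4 sin²(π/(Nℓ)) · Σ_{x,y<ℓ} [S(a₀) + S(a₁)] ≤ Σ_{x,y<ℓ} S(∂₀a₁ − ∂₁a₀)` — at tree level the Hessian of the Wilson action at the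
twist-eating configuration, restricted to the gauge slice, has no zero mode and gap `≥ 4 sin²(π/(Nℓ))` («the irreducibility
condition eliminates the presence of zero-modes which complicate the perturbative analysis»).
[cite: GarciaperezGonzalezarroyoOkawa2017, §2.2] [cite: GarciaperezGonzalezarroyoOkawa2014, §3] -/
theorem twistedTorus_oneForm_gap_of_div_eq_zero (hAu : A ∈ Matrix.unitaryGroup (Fin N) ℂ)
    (hBu : B ∈ Matrix.unitaryGroup (Fin N) ℂ) (hω : IsPrimitiveRoot ω N) (hAB : A * B = ω • (B * A))
    (h00 : ∀ x y, a₀ (x + ℓ) y = A * a₀ x y * Aᴴ) (h01 : ∀ x y, a₀ x (y + ℓ) = B * a₀ x y * Bᴴ)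
    (h10 : ∀ x y, a₁ (x + ℓ) y = A * a₁ x y * Aᴴ) (h11 : ∀ x y, a₁ x (y + ℓ) = B * a₁ x y * Bᴴ)
    (htr0 : ∀ x y, (a₀ x y).trace = 0) (htr1 : ∀ x y, (a₁ x y).trace = 0)
    (hdiv : ∀ x y, (a₀ (x + 1) (y + 1) - a₀ x (y + 1)) + (a₁ (x + 1) (y + 1) - a₁ (x + 1) y) = 0) :
    4 * Real.sin (Real.pi / ((N : ℝ) * ℓ)) ^ 2 *
        ∑ x ∈ range ℓ, ∑ y ∈ range ℓ, ((((a₀ x y)ᴴ * a₀ x y).trace).re + (((a₁ x y)ᴴ * a₁ x y).trace).re) ≤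
      ∑ x ∈ range ℓ, ∑ y ∈ range ℓ,
        ((((a₁ (x + 1) y - a₁ x y) - (a₀ x (y + 1) - a₀ x y))ᴴ *
          ((a₁ (x + 1) y - a₁ x y) - (a₀ x (y + 1) - a₀ x y))).trace).re := by
  have h := twistedTorus_oneForm_gap hAu hBu hω hAB h00 h01 h10 h11 htr0 htr1
  simp_rw [hdiv, Matrix.conjTranspose_zero, Matrix.zero_mul, Matrix.trace_zero, Complex.zero_re,
    Finset.sum_const_zero, add_zero] at h
  exact h

end OneForm

/-! ## §5 The twisted SLAB `ℓ × ℓ × L` (two twist-eating directions, one periodic direction of any length `L`):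
explicit identity and the Coulomb-gauge Hessian bound, UNIFORM in `L` -/

section SlabKit

/-- Window shift in the first index, rectangular window. [folklore] -/
private theorem wsum_shift_fst {F : ℕ → ℕ → ℝ} {ℓ₁ ℓ₂ : ℕ} (hF : ∀ x y, F (x + ℓ₁) y = F x y) :
    ∑ x ∈ range ℓ₁, ∑ y ∈ range ℓ₂, F (x + 1) y = ∑ x ∈ range ℓ₁, ∑ y ∈ range ℓ₂, F x y := by
  calc ∑ x ∈ range ℓ₁, ∑ y ∈ range ℓ₂, F (x + 1) y = ∑ y ∈ range ℓ₂, ∑ x ∈ range ℓ₁, F (x + 1) y := Finset.sum_comm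
    _ = ∑ y ∈ range ℓ₂, ∑ x ∈ range ℓ₁, F x y :=
        Finset.sum_congr rfl fun y _ => sum_range_shift_one (F := fun x => F x y) fun x => hF x y
    _ = ∑ x ∈ range ℓ₁, ∑ y ∈ range ℓ₂, F x y := Finset.sum_comm

/-- Window shift in the second index, rectangular window. [folklore] -/
private theorem wsum_shift_snd {F : ℕ → ℕ → ℝ} {ℓ₁ ℓ₂ : ℕ} (hF : ∀ x y, F x (y + ℓ₂) = F x y) :
    ∑ x ∈ range ℓ₁, ∑ y ∈ range ℓ₂, F x (y + 1) = ∑ x ∈ range ℓ₁, ∑ y ∈ range ℓ₂, F x y :=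
  Finset.sum_congr rfl fun x _ => sum_range_shift_one (F := fun y => F x y) fun y => hF x y

variable {U V : Matrix (Fin N) (Fin N) ℂ} {ℓ₁ ℓ₂ : ℕ} {b₀ b₁ : ℕ → ℕ → Matrix (Fin N) (Fin N) ℂ}

/-- The cross terms on a rectangular `ℓ₁ × ℓ₂` window with twists `U`, `V`:
`Σ Re tr((∇₀⁻b₀)†(∇₁⁻b₁))(x+1,y+1) = Σ Re tr((∂₀b₁)†(∂₁b₀))(x,y)`. [folklore] -/
private theorem cross_terms_eq_rect (hU : Uᴴ * U = 1) (hV : Vᴴ * V = 1)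
    (h00 : ∀ x y, b₀ (x + ℓ₁) y = U * b₀ x y * Uᴴ) (h01 : ∀ x y, b₀ x (y + ℓ₂) = V * b₀ x y * Vᴴ)
    (h10 : ∀ x y, b₁ (x + ℓ₁) y = U * b₁ x y * Uᴴ) (h11 : ∀ x y, b₁ x (y + ℓ₂) = V * b₁ x y * Vᴴ) :
    ∑ x ∈ range ℓ₁, ∑ y ∈ range ℓ₂,
        (((b₀ (x + 1) (y + 1) - b₀ x (y + 1))ᴴ * (b₁ (x + 1) (y + 1) - b₁ (x + 1) y)).trace).re =
      ∑ x ∈ range ℓ₁, ∑ y ∈ range ℓ₂,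
        (((b₁ (x + 1) y - b₁ x y)ᴴ * (b₀ x (y + 1) - b₀ x y)).trace).re := by
  have hT1 : ∑ x ∈ range ℓ₁, ∑ y ∈ range ℓ₂, (((b₀ (x + 1) (y + 1))ᴴ * b₁ (x + 1) (y + 1)).trace).re =
      ∑ x ∈ range ℓ₁, ∑ y ∈ range ℓ₂, (((b₀ x y)ᴴ * b₁ x y).trace).re := by
    have h1 := wsum_shift_fst (F := fun x y => (((b₀ x (y + 1))ᴴ * b₁ x (y + 1)).trace).re) (ℓ₁ := ℓ₁) (ℓ₂ := ℓ₂)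
      (fun x y => by rw [h00, h10, hsRe_conj hU])
    have h2 := wsum_shift_snd (F := fun x y => (((b₀ x y)ᴴ * b₁ x y).trace).re) (ℓ₁ := ℓ₁) (ℓ₂ := ℓ₂)
      (fun x y => by rw [h01, h11, hsRe_conj hV])
    rw [h1, h2]
  have hT2 : ∑ x ∈ range ℓ₁, ∑ y ∈ range ℓ₂, (((b₀ (x + 1) (y + 1))ᴴ * b₁ (x + 1) y).trace).re =
      ∑ x ∈ range ℓ₁, ∑ y ∈ range ℓ₂, (((b₀ x (y + 1))ᴴ * b₁ x y).trace).re := by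
    have h1 := wsum_shift_fst (F := fun x y => (((b₀ x (y + 1))ᴴ * b₁ x y).trace).re) (ℓ₁ := ℓ₁) (ℓ₂ := ℓ₂)
      (fun x y => by rw [h00, h10, hsRe_conj hU])
    rw [h1]
  have hT3 : ∑ x ∈ range ℓ₁, ∑ y ∈ range ℓ₂, (((b₀ x (y + 1))ᴴ * b₁ (x + 1) (y + 1)).trace).re =
      ∑ x ∈ range ℓ₁, ∑ y ∈ range ℓ₂, (((b₀ x y)ᴴ * b₁ (x + 1) y).trace).re := by
    have h2 := wsum_shift_snd (F := fun x y => (((b₀ x y)ᴴ * b₁ (x + 1) y).trace).re) (ℓ₁ := ℓ₁) (ℓ₂ := ℓ₂)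
      (fun x y => by rw [h01, h11, hsRe_conj hV])
    rw [h2]
  have hL : ∀ x y, (((b₀ (x + 1) (y + 1) - b₀ x (y + 1))ᴴ * (b₁ (x + 1) (y + 1) - b₁ (x + 1) y)).trace).re =
      (((b₀ (x + 1) (y + 1))ᴴ * b₁ (x + 1) (y + 1)).trace).re - (((b₀ (x + 1) (y + 1))ᴴ * b₁ (x + 1) y).trace).re -
        (((b₀ x (y + 1))ᴴ * b₁ (x + 1) (y + 1)).trace).re + (((b₀ x (y + 1))ᴴ * b₁ (x + 1) y).trace).re :=
    fun x y => hsRe_sub_sub _ _ _ _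
  have hR : ∀ x y, (((b₁ (x + 1) y - b₁ x y)ᴴ * (b₀ x (y + 1) - b₀ x y)).trace).re =
      (((b₀ x (y + 1))ᴴ * b₁ (x + 1) y).trace).re - (((b₀ x (y + 1))ᴴ * b₁ x y).trace).re -
        (((b₀ x y)ᴴ * b₁ (x + 1) y).trace).re + (((b₀ x y)ᴴ * b₁ x y).trace).re := by
    intro x y
    rw [hsRe_symm, hsRe_sub_sub]
  simp_rw [hL, hR]
  simp only [Finset.sum_add_distrib, Finset.sum_sub_distrib]
  rw [hT1, hT2, hT3]
  ring

/-- `Re tr((X + X')†Y) = Re tr(X†Y) + Re tr(X'†Y)`. [folklore] -/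
private theorem hsRe_add_left (X X' Y : Matrix (Fin N) (Fin N) ℂ) :
    (((X + X')ᴴ * Y).trace).re = ((Xᴴ * Y).trace).re + ((X'ᴴ * Y).trace).re := by
  rw [Matrix.conjTranspose_add, Matrix.add_mul, Matrix.trace_add, Complex.add_re]

/-- A periodic field is twisted-periodic with the trivial twist `1`. [folklore] -/
private theorem periodic_as_twisted {f : ℕ → Matrix (Fin N) (Fin N) ℂ} {L : ℕ} (hf : ∀ u, f (u + L) = f u) (u : ℕ) :
    f (u + L) = 1 * f u * (1 : Matrix (Fin N) (Fin N) ℂ)ᴴ := by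
  rw [Matrix.conjTranspose_one, Matrix.one_mul, Matrix.mul_one, hf]

/-- `1†1 = 1`. [folklore] -/
private theorem one_conjTranspose_mul_one : (1 : Matrix (Fin N) (Fin N) ℂ)ᴴ * 1 = 1 := by
  rw [Matrix.conjTranspose_one, Matrix.mul_one]

/-- Triple-window shift in the first index. [folklore] -/
private theorem w3_shift_x {F : ℕ → ℕ → ℕ → ℝ} {ℓ₁ ℓ₂ ℓ₃ : ℕ} (hF : ∀ x y u, F (x + ℓ₁) y u = F x y u) :
    ∑ x ∈ range ℓ₁, ∑ y ∈ range ℓ₂, ∑ u ∈ range ℓ₃, F (x + 1) y u =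
      ∑ x ∈ range ℓ₁, ∑ y ∈ range ℓ₂, ∑ u ∈ range ℓ₃, F x y u :=
  sum_range_shift_one (F := fun x => ∑ y ∈ range ℓ₂, ∑ u ∈ range ℓ₃, F x y u) fun x =>
    Finset.sum_congr rfl fun y _ => Finset.sum_congr rfl fun u _ => hF x y u

/-- Triple-window shift in the second index. [folklore] -/
private theorem w3_shift_y {F : ℕ → ℕ → ℕ → ℝ} {ℓ₁ ℓ₂ ℓ₃ : ℕ} (hF : ∀ x y u, F x (y + ℓ₂) u = F x y u) :
    ∑ x ∈ range ℓ₁, ∑ y ∈ range ℓ₂, ∑ u ∈ range ℓ₃, F x (y + 1) u =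
      ∑ x ∈ range ℓ₁, ∑ y ∈ range ℓ₂, ∑ u ∈ range ℓ₃, F x y u :=
  Finset.sum_congr rfl fun x _ =>
    sum_range_shift_one (F := fun y => ∑ u ∈ range ℓ₃, F x y u) fun y =>
      Finset.sum_congr rfl fun u _ => hF x y u

/-- Triple-window shift in the third index. [folklore] -/
private theorem w3_shift_u {F : ℕ → ℕ → ℕ → ℝ} {ℓ₁ ℓ₂ ℓ₃ : ℕ} (hF : ∀ x y u, F x y (u + ℓ₃) = F x y u) :
    ∑ x ∈ range ℓ₁, ∑ y ∈ range ℓ₂, ∑ u ∈ range ℓ₃, F x y (u + 1) =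
      ∑ x ∈ range ℓ₁, ∑ y ∈ range ℓ₂, ∑ u ∈ range ℓ₃, F x y u :=
  Finset.sum_congr rfl fun x _ => Finset.sum_congr rfl fun y _ =>
    sum_range_shift_one (F := fun u => F x y u) fun u => hF x y u

/-- Bring the third index outermost. [folklore] -/
private theorem w3_comm_u {F : ℕ → ℕ → ℕ → ℝ} {ℓ₁ ℓ₂ ℓ₃ : ℕ} :
    ∑ x ∈ range ℓ₁, ∑ y ∈ range ℓ₂, ∑ u ∈ range ℓ₃, F x y u =
      ∑ u ∈ range ℓ₃, ∑ x ∈ range ℓ₁, ∑ y ∈ range ℓ₂, F x y u := by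
  calc ∑ x ∈ range ℓ₁, ∑ y ∈ range ℓ₂, ∑ u ∈ range ℓ₃, F x y u
      = ∑ x ∈ range ℓ₁, ∑ u ∈ range ℓ₃, ∑ y ∈ range ℓ₂, F x y u :=
        Finset.sum_congr rfl fun x _ => Finset.sum_comm
    _ = ∑ u ∈ range ℓ₃, ∑ x ∈ range ℓ₁, ∑ y ∈ range ℓ₂, F x y u := Finset.sum_comm

end SlabKit

section Slab

variable {A B : Matrix (Fin N) (Fin N) ℂ} {ℓ L : ℕ} {a₀ a₁ a₂ : ℕ → ℕ → ℕ → Matrix (Fin N) (Fin N) ℂ}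

/-- ★ **The discrete Weitzenböck identity on the twisted SLAB `ℓ × ℓ × L`, explicit form.**  For 1-forms `a₀, a₁, a₂` on the slab
(twist-eating boundary conditions `Ad A`, `Ad B` in the two short directions, plain periodicity of any length `L` in the third; `A, B`
unitary) the three plaquette squares `S(∂_μ a_ν − ∂_ν a_μ)` plus the squared backward covariant divergence
`S((∇₀⁻a₀ + ∇₁⁻a₁ + ∇₂⁻a₂)(x+1,y+1,u+1))`, summed over one period, equal the nine componentwise Dirichlet terms `Σ_{μ,ν} S(∂_μ a_ν)`
(quadratic Wilson action + `ξ = 1` background-field gauge term = componentwise covariant Laplacian).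
[cite: GarciaperezGonzalezarroyoOkawa2017, §2.5] [cite: GarciaperezGonzalezarroyoOkawa2014, §3] -/
theorem twistedSlab_oneForm_weitzenboeck (hAu : A ∈ Matrix.unitaryGroup (Fin N) ℂ) (hBu : B ∈ Matrix.unitaryGroup (Fin N) ℂ)
    (h0A : ∀ x y u, a₀ (x + ℓ) y u = A * a₀ x y u * Aᴴ) (h0B : ∀ x y u, a₀ x (y + ℓ) u = B * a₀ x y u * Bᴴ)
    (h0L : ∀ x y u, a₀ x y (u + L) = a₀ x y u)
    (h1A : ∀ x y u, a₁ (x + ℓ) y u = A * a₁ x y u * Aᴴ) (h1B : ∀ x y u, a₁ x (y + ℓ) u = B * a₁ x y u * Bᴴ)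
    (h1L : ∀ x y u, a₁ x y (u + L) = a₁ x y u)
    (h2A : ∀ x y u, a₂ (x + ℓ) y u = A * a₂ x y u * Aᴴ) (h2B : ∀ x y u, a₂ x (y + ℓ) u = B * a₂ x y u * Bᴴ)
    (h2L : ∀ x y u, a₂ x y (u + L) = a₂ x y u) :
    ∑ x ∈ range ℓ, ∑ y ∈ range ℓ, ∑ u ∈ range L,
        (((((a₁ (x + 1) y u - a₁ x y u) - (a₀ x (y + 1) u - a₀ x y u))ᴴ *
            ((a₁ (x + 1) y u - a₁ x y u) - (a₀ x (y + 1) u - a₀ x y u))).trace).re +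
          ((((a₂ (x + 1) y u - a₂ x y u) - (a₀ x y (u + 1) - a₀ x y u))ᴴ *
            ((a₂ (x + 1) y u - a₂ x y u) - (a₀ x y (u + 1) - a₀ x y u))).trace).re +
          ((((a₂ x (y + 1) u - a₂ x y u) - (a₁ x y (u + 1) - a₁ x y u))ᴴ *
            ((a₂ x (y + 1) u - a₂ x y u) - (a₁ x y (u + 1) - a₁ x y u))).trace).re) +
      ∑ x ∈ range ℓ, ∑ y ∈ range ℓ, ∑ u ∈ range L,
        ((((a₀ (x + 1) (y + 1) (u + 1) - a₀ x (y + 1) (u + 1)) + (a₁ (x + 1) (y + 1) (u + 1) - a₁ (x + 1) y (u + 1)) +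
            (a₂ (x + 1) (y + 1) (u + 1) - a₂ (x + 1) (y + 1) u))ᴴ *
          ((a₀ (x + 1) (y + 1) (u + 1) - a₀ x (y + 1) (u + 1)) + (a₁ (x + 1) (y + 1) (u + 1) - a₁ (x + 1) y (u + 1)) +
            (a₂ (x + 1) (y + 1) (u + 1) - a₂ (x + 1) (y + 1) u))).trace).re =
      ∑ x ∈ range ℓ, ∑ y ∈ range ℓ, ∑ u ∈ range L,
        ((((a₀ (x + 1) y u - a₀ x y u)ᴴ * (a₀ (x + 1) y u - a₀ x y u)).trace).re +
          (((a₀ x (y + 1) u - a₀ x y u)ᴴ * (a₀ x (y + 1) u - a₀ x y u)).trace).re +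
          (((a₀ x y (u + 1) - a₀ x y u)ᴴ * (a₀ x y (u + 1) - a₀ x y u)).trace).re +
          (((a₁ (x + 1) y u - a₁ x y u)ᴴ * (a₁ (x + 1) y u - a₁ x y u)).trace).re +
          (((a₁ x (y + 1) u - a₁ x y u)ᴴ * (a₁ x (y + 1) u - a₁ x y u)).trace).re +
          (((a₁ x y (u + 1) - a₁ x y u)ᴴ * (a₁ x y (u + 1) - a₁ x y u)).trace).re +
          (((a₂ (x + 1) y u - a₂ x y u)ᴴ * (a₂ (x + 1) y u - a₂ x y u)).trace).re +
          (((a₂ x (y + 1) u - a₂ x y u)ᴴ * (a₂ x (y + 1) u - a₂ x y u)).trace).re +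
          (((a₂ x y (u + 1) - a₂ x y u)ᴴ * (a₂ x y (u + 1) - a₂ x y u)).trace).re) := by
  have hA : Aᴴ * A = 1 := hAu.1
  have hB : Bᴴ * B = 1 := hBu.1
  have h1 : (1 : Matrix (Fin N) (Fin N) ℂ)ᴴ * 1 = 1 := one_conjTranspose_mul_one
  -- diagonal terms of the divergence square: shift back to the unshifted window
  have hD0 : ∑ x ∈ range ℓ, ∑ y ∈ range ℓ, ∑ u ∈ range L,
      (((a₀ (x + 1) (y + 1) (u + 1) - a₀ x (y + 1) (u + 1))ᴴ * (a₀ (x + 1) (y + 1) (u + 1) - a₀ x (y + 1) (u + 1))).trace).re =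
      ∑ x ∈ range ℓ, ∑ y ∈ range ℓ, ∑ u ∈ range L,
        (((a₀ (x + 1) y u - a₀ x y u)ᴴ * (a₀ (x + 1) y u - a₀ x y u)).trace).re := by
    have hy := w3_shift_y (ℓ₁ := ℓ) (ℓ₂ := ℓ) (ℓ₃ := L)
      (F := fun x y u => (((a₀ (x + 1) y (u + 1) - a₀ x y (u + 1))ᴴ * (a₀ (x + 1) y (u + 1) - a₀ x y (u + 1))).trace).re)
      (fun x y u => by rw [h0B, h0B, ← Matrix.sub_mul, ← Matrix.mul_sub, re_trace_conjTranspose_mul_self_conj hB])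
    have hu := w3_shift_u (ℓ₁ := ℓ) (ℓ₂ := ℓ) (ℓ₃ := L)
      (F := fun x y u => (((a₀ (x + 1) y u - a₀ x y u)ᴴ * (a₀ (x + 1) y u - a₀ x y u)).trace).re)
      (fun x y u => by rw [h0L, h0L])
    rw [hy, hu]
  have hD1 : ∑ x ∈ range ℓ, ∑ y ∈ range ℓ, ∑ u ∈ range L,
      (((a₁ (x + 1) (y + 1) (u + 1) - a₁ (x + 1) y (u + 1))ᴴ * (a₁ (x + 1) (y + 1) (u + 1) - a₁ (x + 1) y (u + 1))).trace).re =
      ∑ x ∈ range ℓ, ∑ y ∈ range ℓ, ∑ u ∈ range L,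
        (((a₁ x (y + 1) u - a₁ x y u)ᴴ * (a₁ x (y + 1) u - a₁ x y u)).trace).re := by
    have hx := w3_shift_x (ℓ₁ := ℓ) (ℓ₂ := ℓ) (ℓ₃ := L)
      (F := fun x y u => (((a₁ x (y + 1) (u + 1) - a₁ x y (u + 1))ᴴ * (a₁ x (y + 1) (u + 1) - a₁ x y (u + 1))).trace).re)
      (fun x y u => by rw [h1A, h1A, ← Matrix.sub_mul, ← Matrix.mul_sub, re_trace_conjTranspose_mul_self_conj hA])
    have hu := w3_shift_u (ℓ₁ := ℓ) (ℓ₂ := ℓ) (ℓ₃ := L)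
      (F := fun x y u => (((a₁ x (y + 1) u - a₁ x y u)ᴴ * (a₁ x (y + 1) u - a₁ x y u)).trace).re)
      (fun x y u => by rw [h1L, h1L])
    rw [hx, hu]
  have hD2 : ∑ x ∈ range ℓ, ∑ y ∈ range ℓ, ∑ u ∈ range L,
      (((a₂ (x + 1) (y + 1) (u + 1) - a₂ (x + 1) (y + 1) u)ᴴ * (a₂ (x + 1) (y + 1) (u + 1) - a₂ (x + 1) (y + 1) u)).trace).re =
      ∑ x ∈ range ℓ, ∑ y ∈ range ℓ, ∑ u ∈ range L,
        (((a₂ x y (u + 1) - a₂ x y u)ᴴ * (a₂ x y (u + 1) - a₂ x y u)).trace).re := by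
    have hx := w3_shift_x (ℓ₁ := ℓ) (ℓ₂ := ℓ) (ℓ₃ := L)
      (F := fun x y u => (((a₂ x (y + 1) (u + 1) - a₂ x (y + 1) u)ᴴ * (a₂ x (y + 1) (u + 1) - a₂ x (y + 1) u)).trace).re)
      (fun x y u => by rw [h2A, h2A, ← Matrix.sub_mul, ← Matrix.mul_sub, re_trace_conjTranspose_mul_self_conj hA])
    have hy := w3_shift_y (ℓ₁ := ℓ) (ℓ₂ := ℓ) (ℓ₃ := L)
      (F := fun x y u => (((a₂ x y (u + 1) - a₂ x y u)ᴴ * (a₂ x y (u + 1) - a₂ x y u)).trace).re)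
      (fun x y u => by rw [h2B, h2B, ← Matrix.sub_mul, ← Matrix.mul_sub, re_trace_conjTranspose_mul_self_conj hB])
    rw [hx, hy]
  -- cross terms (0,1): slice at fixed `u + 1`, then shift `u`
  have hX01 : ∑ x ∈ range ℓ, ∑ y ∈ range ℓ, ∑ u ∈ range L,
      (((a₀ (x + 1) (y + 1) (u + 1) - a₀ x (y + 1) (u + 1))ᴴ * (a₁ (x + 1) (y + 1) (u + 1) - a₁ (x + 1) y (u + 1))).trace).re =
      ∑ x ∈ range ℓ, ∑ y ∈ range ℓ, ∑ u ∈ range L,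
        (((a₁ (x + 1) y u - a₁ x y u)ᴴ * (a₀ x (y + 1) u - a₀ x y u)).trace).re := by
    have hslice : ∀ u, ∑ x ∈ range ℓ, ∑ y ∈ range ℓ,
        (((a₀ (x + 1) (y + 1) (u + 1) - a₀ x (y + 1) (u + 1))ᴴ * (a₁ (x + 1) (y + 1) (u + 1) - a₁ (x + 1) y (u + 1))).trace).re =
        ∑ x ∈ range ℓ, ∑ y ∈ range ℓ,
          (((a₁ (x + 1) y (u + 1) - a₁ x y (u + 1))ᴴ * (a₀ x (y + 1) (u + 1) - a₀ x y (u + 1))).trace).re := fun u =>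
      cross_terms_eq_rect (b₀ := fun x y => a₀ x y (u + 1)) (b₁ := fun x y => a₁ x y (u + 1)) hA hB
        (fun x y => h0A x y (u + 1)) (fun x y => h0B x y (u + 1)) (fun x y => h1A x y (u + 1)) (fun x y => h1B x y (u + 1))
    rw [w3_comm_u, w3_comm_u (F := fun x y u => (((a₁ (x + 1) y u - a₁ x y u)ᴴ * (a₀ x (y + 1) u - a₀ x y u)).trace).re)]
    have hu := w3_shift_u (ℓ₁ := ℓ) (ℓ₂ := ℓ) (ℓ₃ := L)
      (F := fun x y u => (((a₁ (x + 1) y u - a₁ x y u)ᴴ * (a₀ x (y + 1) u - a₀ x y u)).trace).re)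
      (fun x y u => by rw [h1L, h1L, h0L, h0L])
    rw [w3_comm_u, w3_comm_u (F := fun x y u => (((a₁ (x + 1) y u - a₁ x y u)ᴴ * (a₀ x (y + 1) u - a₀ x y u)).trace).re)] at hu
    rw [← hu]
    exact Finset.sum_congr rfl fun u _ => hslice u
  -- cross terms (0,2): slice at fixed `y + 1` in the variables `(x, u)`, then shift `y`
  have hX02 : ∑ x ∈ range ℓ, ∑ y ∈ range ℓ, ∑ u ∈ range L,
      (((a₀ (x + 1) (y + 1) (u + 1) - a₀ x (y + 1) (u + 1))ᴴ * (a₂ (x + 1) (y + 1) (u + 1) - a₂ (x + 1) (y + 1) u)).trace).re =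
      ∑ x ∈ range ℓ, ∑ y ∈ range ℓ, ∑ u ∈ range L,
        (((a₂ (x + 1) y u - a₂ x y u)ᴴ * (a₀ x y (u + 1) - a₀ x y u)).trace).re := by
    have hslice : ∀ y, ∑ x ∈ range ℓ, ∑ u ∈ range L,
        (((a₀ (x + 1) (y + 1) (u + 1) - a₀ x (y + 1) (u + 1))ᴴ * (a₂ (x + 1) (y + 1) (u + 1) - a₂ (x + 1) (y + 1) u)).trace).re =
        ∑ x ∈ range ℓ, ∑ u ∈ range L,
          (((a₂ (x + 1) (y + 1) u - a₂ x (y + 1) u)ᴴ * (a₀ x (y + 1) (u + 1) - a₀ x (y + 1) u)).trace).re := fun y =>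
      cross_terms_eq_rect (b₀ := fun x u => a₀ x (y + 1) u) (b₁ := fun x u => a₂ x (y + 1) u) hA h1
        (fun x u => h0A x (y + 1) u) (fun x u => periodic_as_twisted (f := fun u => a₀ x (y + 1) u) (fun u => h0L x (y + 1) u) u)
        (fun x u => h2A x (y + 1) u) (fun x u => periodic_as_twisted (f := fun u => a₂ x (y + 1) u) (fun u => h2L x (y + 1) u) u)
    have hy := w3_shift_y (ℓ₁ := ℓ) (ℓ₂ := ℓ) (ℓ₃ := L)
      (F := fun x y u => (((a₂ (x + 1) y u - a₂ x y u)ᴴ * (a₀ x y (u + 1) - a₀ x y u)).trace).re)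
      (fun x y u => by rw [h2B, h2B, h0B, h0B, ← Matrix.sub_mul, ← Matrix.mul_sub, ← Matrix.sub_mul, ← Matrix.mul_sub,
        hsRe_conj hB])
    rw [← hy]
    rw [Finset.sum_comm, Finset.sum_comm (f := fun x y => ∑ u ∈ range L,
      (((a₂ (x + 1) (y + 1) u - a₂ x (y + 1) u)ᴴ * (a₀ x (y + 1) (u + 1) - a₀ x (y + 1) u)).trace).re)]
    exact Finset.sum_congr rfl fun y _ => hslice y
  -- cross terms (1,2): slice at fixed `x + 1` in the variables `(y, u)`, then shift `x`
  have hX12 : ∑ x ∈ range ℓ, ∑ y ∈ range ℓ, ∑ u ∈ range L,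
      (((a₁ (x + 1) (y + 1) (u + 1) - a₁ (x + 1) y (u + 1))ᴴ * (a₂ (x + 1) (y + 1) (u + 1) - a₂ (x + 1) (y + 1) u)).trace).re =
      ∑ x ∈ range ℓ, ∑ y ∈ range ℓ, ∑ u ∈ range L,
        (((a₂ x (y + 1) u - a₂ x y u)ᴴ * (a₁ x y (u + 1) - a₁ x y u)).trace).re := by
    have hslice : ∀ x, ∑ y ∈ range ℓ, ∑ u ∈ range L,
        (((a₁ (x + 1) (y + 1) (u + 1) - a₁ (x + 1) y (u + 1))ᴴ * (a₂ (x + 1) (y + 1) (u + 1) - a₂ (x + 1) (y + 1) u)).trace).re =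
        ∑ y ∈ range ℓ, ∑ u ∈ range L,
          (((a₂ (x + 1) (y + 1) u - a₂ (x + 1) y u)ᴴ * (a₁ (x + 1) y (u + 1) - a₁ (x + 1) y u)).trace).re := fun x =>
      cross_terms_eq_rect (b₀ := fun y u => a₁ (x + 1) y u) (b₁ := fun y u => a₂ (x + 1) y u) hB h1
        (fun y u => h1B (x + 1) y u) (fun y u => periodic_as_twisted (f := fun u => a₁ (x + 1) y u) (fun u => h1L (x + 1) y u) u)
        (fun y u => h2B (x + 1) y u) (fun y u => periodic_as_twisted (f := fun u => a₂ (x + 1) y u) (fun u => h2L (x + 1) y u) u)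
    have hx := w3_shift_x (ℓ₁ := ℓ) (ℓ₂ := ℓ) (ℓ₃ := L)
      (F := fun x y u => (((a₂ x (y + 1) u - a₂ x y u)ᴴ * (a₁ x y (u + 1) - a₁ x y u)).trace).re)
      (fun x y u => by rw [h2A, h2A, h1A, h1A, ← Matrix.sub_mul, ← Matrix.mul_sub, ← Matrix.sub_mul, ← Matrix.mul_sub,
        hsRe_conj hA])
    rw [← hx]
    exact Finset.sum_congr rfl fun x _ => hslice x
  -- expand the squares
  have hcurl : ∀ X Y : Matrix (Fin N) (Fin N) ℂ, (((X - Y)ᴴ * (X - Y)).trace).re =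
      ((Xᴴ * X).trace).re + ((Yᴴ * Y).trace).re - 2 * ((Xᴴ * Y).trace).re := fun X Y => hsS_sub X Y
  have hdiv : ∀ X Y Z : Matrix (Fin N) (Fin N) ℂ, (((X + Y + Z)ᴴ * (X + Y + Z)).trace).re =
      ((Xᴴ * X).trace).re + ((Yᴴ * Y).trace).re + ((Zᴴ * Z).trace).re +
        2 * ((Xᴴ * Y).trace).re + 2 * ((Xᴴ * Z).trace).re + 2 * ((Yᴴ * Z).trace).re := by
    intro X Y Z
    rw [hsS_add, hsS_add, hsRe_add_left]
    ring
  simp_rw [hcurl (a₁ _ _ _ - a₁ _ _ _), hcurl (a₂ _ _ _ - a₂ _ _ _), hdiv]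
  simp only [Finset.sum_add_distrib, Finset.sum_sub_distrib, ← Finset.mul_sum]
  rw [hD0, hD1, hD2, hX01, hX02, hX12]
  ring

variable [NeZero N] {ω : ℂ}

/-- ★★ **Feynman-gauge gap for 1-forms on the twisted slab, uniform in the long direction.**  For a unitary Weyl pair
`A B = ω·B A` (`ω` primitive) and traceless 1-forms `a₀, a₁, a₂` on the slab `ℓ × ℓ × L` (twist-eating in `x, y`, periodic of
ANY length `L` in `u`):
`4 sin²(π/(Nℓ)) · Σ_{x,y<ℓ, u<L} [S(a₀) + S(a₁) + S(a₂)] ≤ Σ [S(∂₀a₁ − ∂₁a₀) + S(∂₀a₂ − ∂₂a₀) + S(∂₁a₂ − ∂₂a₁)] + Σ S(div)` —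
the constant does not depend on `L` (the longitudinal differences only add non-negative terms; the twisted directions alone
gap every component). [cite: GarciaperezGonzalezarroyoOkawa2017, §2.5] [cite: GarciaperezGonzalezarroyoOkawa2014, §3] -/
theorem twistedSlab_oneForm_gap (hAu : A ∈ Matrix.unitaryGroup (Fin N) ℂ) (hBu : B ∈ Matrix.unitaryGroup (Fin N) ℂ)
    (hω : IsPrimitiveRoot ω N) (hAB : A * B = ω • (B * A))
    (h0A : ∀ x y u, a₀ (x + ℓ) y u = A * a₀ x y u * Aᴴ) (h0B : ∀ x y u, a₀ x (y + ℓ) u = B * a₀ x y u * Bᴴ)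
    (h0L : ∀ x y u, a₀ x y (u + L) = a₀ x y u)
    (h1A : ∀ x y u, a₁ (x + ℓ) y u = A * a₁ x y u * Aᴴ) (h1B : ∀ x y u, a₁ x (y + ℓ) u = B * a₁ x y u * Bᴴ)
    (h1L : ∀ x y u, a₁ x y (u + L) = a₁ x y u)
    (h2A : ∀ x y u, a₂ (x + ℓ) y u = A * a₂ x y u * Aᴴ) (h2B : ∀ x y u, a₂ x (y + ℓ) u = B * a₂ x y u * Bᴴ)
    (h2L : ∀ x y u, a₂ x y (u + L) = a₂ x y u)
    (htr0 : ∀ x y u, (a₀ x y u).trace = 0) (htr1 : ∀ x y u, (a₁ x y u).trace = 0)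
    (htr2 : ∀ x y u, (a₂ x y u).trace = 0) :
    4 * Real.sin (Real.pi / ((N : ℝ) * ℓ)) ^ 2 *
        ∑ x ∈ range ℓ, ∑ y ∈ range ℓ, ∑ u ∈ range L,
          ((((a₀ x y u)ᴴ * a₀ x y u).trace).re + (((a₁ x y u)ᴴ * a₁ x y u).trace).re +
            (((a₂ x y u)ᴴ * a₂ x y u).trace).re) ≤
      ∑ x ∈ range ℓ, ∑ y ∈ range ℓ, ∑ u ∈ range L,
        (((((a₁ (x + 1) y u - a₁ x y u) - (a₀ x (y + 1) u - a₀ x y u))ᴴ *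
            ((a₁ (x + 1) y u - a₁ x y u) - (a₀ x (y + 1) u - a₀ x y u))).trace).re +
          ((((a₂ (x + 1) y u - a₂ x y u) - (a₀ x y (u + 1) - a₀ x y u))ᴴ *
            ((a₂ (x + 1) y u - a₂ x y u) - (a₀ x y (u + 1) - a₀ x y u))).trace).re +
          ((((a₂ x (y + 1) u - a₂ x y u) - (a₁ x y (u + 1) - a₁ x y u))ᴴ *
            ((a₂ x (y + 1) u - a₂ x y u) - (a₁ x y (u + 1) - a₁ x y u))).trace).re) +
      ∑ x ∈ range ℓ, ∑ y ∈ range ℓ, ∑ u ∈ range L,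
        ((((a₀ (x + 1) (y + 1) (u + 1) - a₀ x (y + 1) (u + 1)) + (a₁ (x + 1) (y + 1) (u + 1) - a₁ (x + 1) y (u + 1)) +
            (a₂ (x + 1) (y + 1) (u + 1) - a₂ (x + 1) (y + 1) u))ᴴ *
          ((a₀ (x + 1) (y + 1) (u + 1) - a₀ x (y + 1) (u + 1)) + (a₁ (x + 1) (y + 1) (u + 1) - a₁ (x + 1) y (u + 1)) +
            (a₂ (x + 1) (y + 1) (u + 1) - a₂ (x + 1) (y + 1) u))).trace).re := by
  rw [twistedSlab_oneForm_weitzenboeck hAu hBu h0A h0B h0L h1A h1B h1L h2A h2B h2L]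
  -- componentwise 0-form gaps on every `u`-slice
  have hcomp : ∀ (c : ℕ → ℕ → ℕ → Matrix (Fin N) (Fin N) ℂ), (∀ x y u, c (x + ℓ) y u = A * c x y u * Aᴴ) →
      (∀ x y u, c x (y + ℓ) u = B * c x y u * Bᴴ) → (∀ x y u, (c x y u).trace = 0) →
      4 * Real.sin (Real.pi / ((N : ℝ) * ℓ)) ^ 2 *
          ∑ x ∈ range ℓ, ∑ y ∈ range ℓ, ∑ u ∈ range L, (((c x y u)ᴴ * c x y u).trace).re ≤
        ∑ x ∈ range ℓ, ∑ y ∈ range ℓ, ∑ u ∈ range L,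
          ((((c (x + 1) y u - c x y u)ᴴ * (c (x + 1) y u - c x y u)).trace).re +
            (((c x (y + 1) u - c x y u)ᴴ * (c x (y + 1) u - c x y u)).trace).re +
            (((c x y (u + 1) - c x y u)ᴴ * (c x y (u + 1) - c x y u)).trace).re) := by
    intro c hcA hcB hctr
    rw [w3_comm_u, w3_comm_u (F := fun x y u => (((c (x + 1) y u - c x y u)ᴴ * (c (x + 1) y u - c x y u)).trace).re +
      (((c x (y + 1) u - c x y u)ᴴ * (c x (y + 1) u - c x y u)).trace).re +
      (((c x y (u + 1) - c x y u)ᴴ * (c x y (u + 1) - c x y u)).trace).re), Finset.mul_sum]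
    refine Finset.sum_le_sum fun u _ => ?_
    have hg := twistedTorus_poincare_sharp (Φ := fun x y => c x y u) hAu hBu hω hAB (fun x y => hcA x y u)
      (fun x y => hcB x y u) (fun x y => hctr x y u)
    refine le_trans hg (Finset.sum_le_sum fun x _ => Finset.sum_le_sum fun y _ => ?_)
    have hnn := re_trace_conjTranspose_mul_self_nonneg (c x y (u + 1) - c x y u)
    linarith
  have h0 := hcomp a₀ h0A h0B htr0
  have h1 := hcomp a₁ h1A h1B htr1
  have h2 := hcomp a₂ h2A h2B htr2
  have hmass : ∑ x ∈ range ℓ, ∑ y ∈ range ℓ, ∑ u ∈ range L,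
      ((((a₀ x y u)ᴴ * a₀ x y u).trace).re + (((a₁ x y u)ᴴ * a₁ x y u).trace).re + (((a₂ x y u)ᴴ * a₂ x y u).trace).re) =
      ∑ x ∈ range ℓ, ∑ y ∈ range ℓ, ∑ u ∈ range L, (((a₀ x y u)ᴴ * a₀ x y u).trace).re +
        ∑ x ∈ range ℓ, ∑ y ∈ range ℓ, ∑ u ∈ range L, (((a₁ x y u)ᴴ * a₁ x y u).trace).re +
        ∑ x ∈ range ℓ, ∑ y ∈ range ℓ, ∑ u ∈ range L, (((a₂ x y u)ᴴ * a₂ x y u).trace).re := by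
    simp only [Finset.sum_add_distrib]
  have hrhs : ∑ x ∈ range ℓ, ∑ y ∈ range ℓ, ∑ u ∈ range L,
        ((((a₀ (x + 1) y u - a₀ x y u)ᴴ * (a₀ (x + 1) y u - a₀ x y u)).trace).re +
          (((a₀ x (y + 1) u - a₀ x y u)ᴴ * (a₀ x (y + 1) u - a₀ x y u)).trace).re +
          (((a₀ x y (u + 1) - a₀ x y u)ᴴ * (a₀ x y (u + 1) - a₀ x y u)).trace).re +
          (((a₁ (x + 1) y u - a₁ x y u)ᴴ * (a₁ (x + 1) y u - a₁ x y u)).trace).re +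
          (((a₁ x (y + 1) u - a₁ x y u)ᴴ * (a₁ x (y + 1) u - a₁ x y u)).trace).re +
          (((a₁ x y (u + 1) - a₁ x y u)ᴴ * (a₁ x y (u + 1) - a₁ x y u)).trace).re +
          (((a₂ (x + 1) y u - a₂ x y u)ᴴ * (a₂ (x + 1) y u - a₂ x y u)).trace).re +
          (((a₂ x (y + 1) u - a₂ x y u)ᴴ * (a₂ x (y + 1) u - a₂ x y u)).trace).re +
          (((a₂ x y (u + 1) - a₂ x y u)ᴴ * (a₂ x y (u + 1) - a₂ x y u)).trace).re) =
      ∑ x ∈ range ℓ, ∑ y ∈ range ℓ, ∑ u ∈ range L,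
          ((((a₀ (x + 1) y u - a₀ x y u)ᴴ * (a₀ (x + 1) y u - a₀ x y u)).trace).re +
            (((a₀ x (y + 1) u - a₀ x y u)ᴴ * (a₀ x (y + 1) u - a₀ x y u)).trace).re +
            (((a₀ x y (u + 1) - a₀ x y u)ᴴ * (a₀ x y (u + 1) - a₀ x y u)).trace).re) +
        ∑ x ∈ range ℓ, ∑ y ∈ range ℓ, ∑ u ∈ range L,
          ((((a₁ (x + 1) y u - a₁ x y u)ᴴ * (a₁ (x + 1) y u - a₁ x y u)).trace).re +
            (((a₁ x (y + 1) u - a₁ x y u)ᴴ * (a₁ x (y + 1) u - a₁ x y u)).trace).re +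
            (((a₁ x y (u + 1) - a₁ x y u)ᴴ * (a₁ x y (u + 1) - a₁ x y u)).trace).re) +
        ∑ x ∈ range ℓ, ∑ y ∈ range ℓ, ∑ u ∈ range L,
          ((((a₂ (x + 1) y u - a₂ x y u)ᴴ * (a₂ (x + 1) y u - a₂ x y u)).trace).re +
            (((a₂ x (y + 1) u - a₂ x y u)ᴴ * (a₂ x (y + 1) u - a₂ x y u)).trace).re +
            (((a₂ x y (u + 1) - a₂ x y u)ᴴ * (a₂ x y (u + 1) - a₂ x y u)).trace).re) := by
    rw [← Finset.sum_add_distrib, ← Finset.sum_add_distrib]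
    refine Finset.sum_congr rfl fun x _ => ?_
    rw [← Finset.sum_add_distrib, ← Finset.sum_add_distrib]
    refine Finset.sum_congr rfl fun y _ => ?_
    rw [← Finset.sum_add_distrib, ← Finset.sum_add_distrib]
    refine Finset.sum_congr rfl fun u _ => ?_
    ring
  rw [hmass, hrhs, mul_add, mul_add]
  exact add_le_add (add_le_add h0 h1) h2

/-- ★ **Coulomb-gauge Hessian bound on the twisted slab, uniform in `L`.**  If the backward covariant divergence vanishes,
`(∇₀⁻a₀ + ∇₁⁻a₁ + ∇₂⁻a₂)(x+1,y+1,u+1) = 0` for all sites, the quadratic Wilson action alone controls the fluctuation: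
`4 sin²(π/(Nℓ)) · Σ [S(a₀) + S(a₁) + S(a₂)] ≤ Σ [S(∂₀a₁ − ∂₁a₀) + S(∂₀a₂ − ∂₂a₀) + S(∂₁a₂ − ∂₂a₁)]` — the tree-level Hessian of the
Wilson action of the twisted slab at the twist-eating configuration has, on the gauge slice, NO ZERO MODE and a gap
`≥ 4 sin²(π/(Nℓ))` INDEPENDENT OF THE LONG EXTENT `L` (no flat direction: «the irreducibility condition eliminates the presence of
zero-modes»). [cite: GarciaperezGonzalezarroyoOkawa2017, §2.2] [cite: GarciaperezGonzalezarroyoOkawa2014, §3] -/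
theorem twistedSlab_oneForm_gap_of_div_eq_zero (hAu : A ∈ Matrix.unitaryGroup (Fin N) ℂ)
    (hBu : B ∈ Matrix.unitaryGroup (Fin N) ℂ) (hω : IsPrimitiveRoot ω N) (hAB : A * B = ω • (B * A))
    (h0A : ∀ x y u, a₀ (x + ℓ) y u = A * a₀ x y u * Aᴴ) (h0B : ∀ x y u, a₀ x (y + ℓ) u = B * a₀ x y u * Bᴴ)
    (h0L : ∀ x y u, a₀ x y (u + L) = a₀ x y u)
    (h1A : ∀ x y u, a₁ (x + ℓ) y u = A * a₁ x y u * Aᴴ) (h1B : ∀ x y u, a₁ x (y + ℓ) u = B * a₁ x y u * Bᴴ)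
    (h1L : ∀ x y u, a₁ x y (u + L) = a₁ x y u)
    (h2A : ∀ x y u, a₂ (x + ℓ) y u = A * a₂ x y u * Aᴴ) (h2B : ∀ x y u, a₂ x (y + ℓ) u = B * a₂ x y u * Bᴴ)
    (h2L : ∀ x y u, a₂ x y (u + L) = a₂ x y u)
    (htr0 : ∀ x y u, (a₀ x y u).trace = 0) (htr1 : ∀ x y u, (a₁ x y u).trace = 0)
    (htr2 : ∀ x y u, (a₂ x y u).trace = 0)
    (hdiv : ∀ x y u, (a₀ (x + 1) (y + 1) (u + 1) - a₀ x (y + 1) (u + 1)) +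
      (a₁ (x + 1) (y + 1) (u + 1) - a₁ (x + 1) y (u + 1)) + (a₂ (x + 1) (y + 1) (u + 1) - a₂ (x + 1) (y + 1) u) = 0) :
    4 * Real.sin (Real.pi / ((N : ℝ) * ℓ)) ^ 2 *
        ∑ x ∈ range ℓ, ∑ y ∈ range ℓ, ∑ u ∈ range L,
          ((((a₀ x y u)ᴴ * a₀ x y u).trace).re + (((a₁ x y u)ᴴ * a₁ x y u).trace).re +
            (((a₂ x y u)ᴴ * a₂ x y u).trace).re) ≤
      ∑ x ∈ range ℓ, ∑ y ∈ range ℓ, ∑ u ∈ range L,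
        (((((a₁ (x + 1) y u - a₁ x y u) - (a₀ x (y + 1) u - a₀ x y u))ᴴ *
            ((a₁ (x + 1) y u - a₁ x y u) - (a₀ x (y + 1) u - a₀ x y u))).trace).re +
          ((((a₂ (x + 1) y u - a₂ x y u) - (a₀ x y (u + 1) - a₀ x y u))ᴴ *
            ((a₂ (x + 1) y u - a₂ x y u) - (a₀ x y (u + 1) - a₀ x y u))).trace).re +
          ((((a₂ x (y + 1) u - a₂ x y u) - (a₁ x y (u + 1) - a₁ x y u))ᴴ *
            ((a₂ x (y + 1) u - a₂ x y u) - (a₁ x y (u + 1) - a₁ x y u))).trace).re) := by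
  have h := twistedSlab_oneForm_gap hAu hBu hω hAB h0A h0B h0L h1A h1B h1L h2A h2B h2L htr0 htr1 htr2
  simp_rw [hdiv, Matrix.conjTranspose_zero, Matrix.zero_mul, Matrix.trace_zero, Complex.zero_re,
    Finset.sum_const_zero, add_zero] at h
  exact h

end Slab

end Literature.MathematicalPhysics.QuantumLattice

end
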